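import Mathlib
import Summits.Ventures.PercRepro2.Defs
import Summits.Ventures.PercRepro2.Independence
import Summits.Ventures.PercRepro2.Harris
import Summits.Ventures.PercRepro2.Graph
import Summits.Ventures.PercRepro2.Exploration
import Summits.Ventures.PercRepro2.Events
import Summits.Ventures.PercRepro2.Induced
import Summits.Ventures.PercRepro2.GateCylinder
import Summits.Ventures.PercRepro2.CCTRootEdge
import Summits.Ventures.PercRepro2.CDNestedStep
import Summits.Ventures.PercRepro2.OneEdge
import Summits.Ventures.PercRepro2.BHKEvents
import Summits.Ventures.PercRepro2.ZCPendantSecondOrder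
import Summits.Ventures.PercRepro2.CDRequired
import Summits.Ventures.PercRepro2.CDNested
import Summits.Ventures.PercRepro2.CDNestedEdgeLemmas

import Summits.Ventures.PercRepro2.CDNestedRouteChain

/-!
# Row 2′CD for the edge `{a₁, a₃}` against a route of any length (blind cell PercRepro2, mine-a g34;
MINE-A.md §89.7, proofs/MINEA-CD-NESTED.md)

The nested-routes theorem for two routes, one of them the direct edge: let `L` be a walk-ordered route
from `a₁` reaching `a₃` with edge set `B ∌ ε = {a₁, a₃}`, and suppose that under `Q` the only
`a₁–a₃` routes are `ε` and `B` (`Q ∩ {a₁ ↔ a₃} = Q ∩ ({ε open} ∪ cyl B)`).  Then the row holds for every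
up-set and every weight vector (`cd_of_edge_and_route`): the cycle with the chord `{a₁, a₃}` and `a₂` on
the cycle, theta graphs with a direct branch, ….  Proof = `CDNested.cd_of_two_worlds` with the worlds
`p[ε ↦ 1]` and `forceOpen (p[ε ↦ 0]) B` (`prob_inter_edge_or_cylinder`), the chains of
`CDNestedRouteChain` from the joined set `{a₁, a₃}`, and the internal edge `ε` once `B` is open
(`prob_forceOpen_insert_eq_zero`).  No definition; one seat.
-/

namespace Summit.Ventures.PercRepro2

namespace CDNestedRoute

section Theorem

variable {V : Type*} {E : Type*} [Fintype E] [DecidableEq E] [Fintype V] [DecidableEq V]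
  {R : Type*} [Field R] [LinearOrder R] [IsStrictOrderedRing R]

omit [Fintype E] [Fintype V] [DecidableEq V] in
/-- The route set built on `insert e B` is `insert e` of the route set built on `B`. -/
lemma foldl_insert_comm (L : List (E × V × V)) :
    ∀ (B : Finset E) (e : E), L.foldl (fun acc t => insert t.1 acc) (insert e B) =
      insert e (L.foldl (fun acc t => insert t.1 acc) B) := by
  induction L with
  | nil => intro B e; simp
  | cons t L ih =>
    intro B e
    simp only [List.foldl_cons]
    rw [Finset.insert_comm, ih]

omit [Fintype E] [Fintype V] [DecidableEq V] [LinearOrder R] [IsStrictOrderedRing R] in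
/-- `forceOpen p {ε} = p[ε ↦ 1]`. -/
lemma forceOpen_singleton (p : E → R) (ε : E) :
    GateCylinder.forceOpen p {ε} = Function.update p ε 1 := by
  funext e
  by_cases h : e = ε
  · subst h; simp [GateCylinder.forceOpen]
  · simp [GateCylinder.forceOpen, h]

omit [Fintype E] [Fintype V] [DecidableEq V] [LinearOrder R] [IsStrictOrderedRing R] in
/-- `forceOpen (p[ε ↦ 0]) B = (forceOpen p B)[ε ↦ 0]` for `ε ∉ B`. -/
lemma forceOpen_update_zero (p : E → R) (B : Finset E) {ε : E} (hε : ε ∉ B) :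
    GateCylinder.forceOpen (Function.update p ε 0) B = Function.update (GateCylinder.forceOpen p B) ε 0 := by
  funext e
  by_cases h : e = ε
  · subst h; simp [GateCylinder.forceOpen, hε]
  · simp [GateCylinder.forceOpen, Function.update_of_ne h]

omit [Fintype V] [DecidableEq V] [LinearOrder R] [IsStrictOrderedRing R] in
/-- **The decomposition of a mass over the edge and the cylinder**: for `ε ∉ B`,
`P_p(X ∩ ({ε open} ∪ cyl B)) = p_ε P_{p[ε↦1]}(X) + (1 − p_ε)(∏_B p) P_{forceOpen (p[ε↦0]) B}(X)`. -/
lemma prob_inter_edge_or_cylinder (p : E → R) (X : Set (Config E)) {ε : E} {B : Finset E}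
    (hε : ε ∉ B) :
    prob p (X ∩ (openEdge ε ∪ GateCylinder.cylinder B)) =
      p ε * prob (Function.update p ε 1) X +
        (1 - p ε) * (∏ b ∈ B, p b) * prob (GateCylinder.forceOpen (Function.update p ε 0) B) X := by
  have hsplit : X ∩ (openEdge ε ∪ GateCylinder.cylinder B) =
      (X ∩ openEdge ε) ∪ ((X ∩ GateCylinder.cylinder B) ∩ closedEdge ε) := by
    ext ω
    simp only [Set.mem_inter_iff, Set.mem_union, openEdge, closedEdge, Set.mem_setOf_eq]
    cases h : ω ε
    · simp
    · simp
  have hdisj : Disjoint (X ∩ openEdge ε) ((X ∩ GateCylinder.cylinder B) ∩ closedEdge ε) := by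
    rw [Set.disjoint_left]
    rintro ω ⟨_, hε'⟩ ⟨_, hε''⟩
    simp only [openEdge, closedEdge, Set.mem_setOf_eq] at hε' hε''
    rw [hε'] at hε''
    exact (Bool.true_eq_false.mp hε'').elim
  rw [hsplit, prob_union_of_disjoint p hdisj, prob_inter_openEdge, prob_inter_closedEdge,
    GateCylinder.prob_inter_cylinder]
  have hprod : ∏ b ∈ B, Function.update p ε 0 b = ∏ b ∈ B, p b :=
    Finset.prod_congr rfl fun b hb => Function.update_of_ne (fun h : b = ε => hε (h ▸ hb)) _ _
  rw [hprod]
  ring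

omit [Fintype V] [DecidableEq V] [LinearOrder R] [IsStrictOrderedRing R] in
/-- **The internal edge**: if every configuration with `B` open connects `a₁` to `a₃`, then for
`ε = {a₁, a₃}` the two forced vectors `forceOpen p (insert ε B)` and `forceOpen (p[ε↦0]) B` give the same
probability to every event determined by connectivity. -/
lemma prob_forceOpen_insert_eq_zero {ends : E → Sym2 V} {ε : E} {a₁ a₃ : V}
    (hε : ends ε = s(a₁, a₃)) (p : E → R) {B : Finset E} (hεB : ε ∉ B)
    (h13 : ∀ ω : Config E, ω ∈ GateCylinder.cylinder B → Conn ends ω a₁ a₃)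
    (X : Set (Config E))
    (hX : ∀ ω ω' : Config E, (∀ u w, Conn ends ω u w ↔ Conn ends ω' u w) → (ω ∈ X ↔ ω' ∈ X)) :
    prob (GateCylinder.forceOpen p (insert ε B)) X =
      prob (GateCylinder.forceOpen (Function.update p ε 0) B) X := by
  rw [CDNestedStep.forceOpen_insert, forceOpen_update_zero p B hεB, CCT.prob_update_one_eq,
    CCT.prob_update_zero_eq]
  unfold prob
  refine Finset.sum_congr rfl fun ω _ => ?_
  by_cases hω : ω ∈ GateCylinder.cylinder B
  · have hc : ∀ u w, Conn ends (Function.update ω ε true) u w ↔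
        Conn ends (Function.update ω ε false) u w := by
      intro u w
      have h13' : Conn ends (Function.update ω ε false) a₁ a₃ := by
        apply h13
        intro b hb
        rw [Function.update_of_ne (fun h : b = ε => hεB (h ▸ hb))]
        exact hω b hb
      have key := OneEdge.conn_update_true_iff hε (Function.update ω ε false) u w
      rw [Function.update_idem] at key
      rw [key]
      constructor
      · rintro (h | ⟨hu, hw⟩ | ⟨hu, hw⟩)
        · exact h
        · exact conn_trans hu (conn_trans h13' hw)
        · exact conn_trans hu (conn_trans (conn_symm h13') hw)
      · exact fun h => Or.inl h
    have hiff := hX _ _ hc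
    by_cases h1 : Function.update ω ε true ∈ X
    · rw [Set.indicator_of_mem (show ω ∈ {ω | Function.update ω ε true ∈ X} from h1),
        Set.indicator_of_mem (show ω ∈ {ω | Function.update ω ε false ∈ X} from hiff.1 h1)]
    · rw [Set.indicator_of_notMem (show ω ∉ {ω | Function.update ω ε true ∈ X} from h1),
        Set.indicator_of_notMem (show ω ∉ {ω | Function.update ω ε false ∈ X} from
          fun h => h1 (hiff.2 h))]
  · have hz := GateCylinder.weight_forceOpen_of_notMem_cylinder p B hω
    rw [Set.indicator_apply_eq_zero.2 (fun _ => hz), Set.indicator_apply_eq_zero.2 (fun _ => hz)]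

omit [Fintype E] [Fintype V] [DecidableEq V] [LinearOrder R] [IsStrictOrderedRing R] in
/-- `forceOpen p ∅ = p`. -/
lemma forceOpen_empty (p : E → R) : GateCylinder.forceOpen p ∅ = p := by
  funext e; simp [GateCylinder.forceOpen]

omit [Fintype E] [DecidableEq E] [Fintype V] in
/-- The walk condition is monotone in the starting set. -/
lemma walk_mono {S S' : Finset V} (hSS' : S ⊆ S') {L : List (E × V × V)}
    (h : ∀ i (hi : i < L.length), (L.get ⟨i, hi⟩).2.1 ∈ S ∪ ((L.take i).map (fun u => u.2.2)).toFinset) :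
    ∀ i (hi : i < L.length), (L.get ⟨i, hi⟩).2.1 ∈ S' ∪ ((L.take i).map (fun u => u.2.2)).toFinset :=
  fun i hi => Finset.union_subset_union hSS' (subset_refl _) (h i hi)

/-- **Row 2′CD for the edge `{a₁, a₃}` against a route of any length.** Let `L` be a walk-ordered route
from `a₁` (each `v` is `a₁` or an earlier `y`) reaching `a₃`, with edge set `B` not containing
`ε = {a₁, a₃}`, and suppose that under `Q` the only `a₁–a₃` routes are `ε` and `B`:
`Q ∩ {a₁ ↔ a₃} = Q ∩ ({ε open} ∪ cyl B)`.  Then the row holds for every up-set and every weight vector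
(the cycle with the chord `{a₁, a₃}` and `a₂` on the cycle, theta graphs with a direct branch, …). -/
theorem cd_of_edge_and_route (p : E → R) (hp : IsProbVec p) {ends : E → Sym2 V} {ε : E}
    {a₁ a₂ a₃ o : V} (hε : ends ε = s(a₁, a₃)) (L : List (E × V × V))
    (hends : ∀ t ∈ L, ends t.1 = s(t.2.1, t.2.2))
    (hwalk : ∀ i (hi : i < L.length), (L.get ⟨i, hi⟩).2.1 ∈
      ({a₁} : Finset V) ∪ ((L.take i).map (fun u => u.2.2)).toFinset)
    (h3 : a₃ ∈ L.foldl (fun acc t => insert t.2.2 acc) ({a₁} : Finset V))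
    (hεL : ε ∉ L.foldl (fun acc t => insert t.1 acc) (∅ : Finset E)) {𝓔 : Set (Set V)} (h𝓔 : IsUpperSet 𝓔)
    (hQe : (connEvent ends a₁ a₂)ᶜ ∩ connEvent ends a₁ a₃ =
      (connEvent ends a₁ a₂)ᶜ ∩ (openEdge ε ∪
        GateCylinder.cylinder (L.foldl (fun acc t => insert t.1 acc) (∅ : Finset E)))) :
    let Q := (connEvent ends a₁ a₂)ᶜ
    let U := clusterInEvent ends a₁ 𝓔
    let e := connEvent ends a₁ a₃
    let f := connEvent ends a₂ o
    let N := (connEvent ends a₁ a₃)ᶜ ∩ (connEvent ends a₂ a₃)ᶜ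
    let oU := connEvent ends a₁ o ∪ connEvent ends a₂ o
    prob p (Q ∩ N) * (prob p Q * prob p (Q ∩ U ∩ e ∩ f) - prob p (Q ∩ U) * prob p (Q ∩ e ∩ f)) ≤
      prob p (Q ∩ N ∩ oU) * (prob p Q * prob p (Q ∩ U ∩ e) - prob p (Q ∩ U) * prob p (Q ∩ e)) := by
  intro Q U e f N oU
  set B := L.foldl (fun acc t => insert t.1 acc) (∅ : Finset E) with hB
  set W := openEdge ε ∪ GateCylinder.cylinder B with hW
  -- the route reaches `a₃`
  have h13 : ∀ ω : Config E, ω ∈ GateCylinder.cylinder B → Conn ends ω a₁ a₃ := by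
    intro ω hω
    exact chain_joined L (∅ : Finset E) ({a₁} : Finset V) (CDNestedStep.joined_singleton ends ∅ a₁) hends hwalk ω hω a₃ h3
  -- the two worlds
  set p₁ := Function.update p ε 1 with hp₁def
  set p₂ := GateCylinder.forceOpen (Function.update p ε 0) B with hp₂def
  have hp₁ : IsProbVec p₁ := hp.update ε zero_le_one le_rfl
  have hp₂ : IsProbVec p₂ := GateCylinder.isProbVec_forceOpen (hp.update ε le_rfl zero_le_one) B
  have hπ : 0 ≤ (1 - p ε) * ∏ b ∈ B, p b :=
    mul_nonneg (sub_nonneg.2 (hp.le_one ε)) (Finset.prod_nonneg fun b _ => hp.nonneg b)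
  -- the pointwise form of `hQe`
  have hpt : ∀ ω, ω ∈ Q → (ω ∈ e ↔ ω ∈ W) := by
    intro ω hQ
    have h := Set.ext_iff.1 hQe ω
    simp only [Set.mem_inter_iff] at h
    exact ⟨fun he => (h.1 ⟨hQ, he⟩).2, fun hc => (h.2 ⟨hQ, hc⟩).2⟩
  have eA : Q ∩ U ∩ e ∩ f = (Q ∩ U ∩ f) ∩ W := by
    ext ω; have h := hpt ω; simp only [Set.mem_inter_iff]; tauto
  have eB : Q ∩ U ∩ e = (Q ∩ U) ∩ W := by
    ext ω; have h := hpt ω; simp only [Set.mem_inter_iff]; tauto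
  have eC : Q ∩ e ∩ f = (Q ∩ f) ∩ W := by
    ext ω; have h := hpt ω; simp only [Set.mem_inter_iff]; tauto
  have eD : Q ∩ e = Q ∩ W := hQe
  -- the forced set of the chain from `{ε}` is `insert ε B`, whose masses are those of `p₂`
  have hchainset : L.foldl (fun acc t => insert t.1 acc) (insert ε (∅ : Finset E)) = insert ε B := by
    rw [foldl_insert_comm L ∅ ε]
  have hstart : GateCylinder.forceOpen p (insert ε (∅ : Finset E)) = p₁ := by
    rw [CDNestedStep.forceOpen_insert, forceOpen_empty]
  have hJ₀ : ∀ ω : Config E, ω ∈ GateCylinder.cylinder (insert ε (∅ : Finset E)) →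
      ∀ v ∈ ({a₁, a₃} : Finset V), Conn ends ω a₁ v := by
    intro ω hω v hv
    simp only [Finset.mem_insert, Finset.mem_singleton] at hv
    rcases hv with rfl | rfl
    · exact conn_refl _ _ _
    · exact conn_of_openAdj ⟨ε, hω ε (Finset.mem_insert_self ε ∅), hε⟩
  have hwalk' := walk_mono (S' := ({a₁, a₃} : Finset V)) (by intro x hx; simp at hx; simp [hx]) hwalk
  have hconnX : ∀ X : Set (Config E), (X = Q ∨ X = Q ∩ U ∨ X = Q ∩ f) →
      prob (GateCylinder.forceOpen p (insert ε B)) X = prob p₂ X := by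
    intro X hX
    refine prob_forceOpen_insert_eq_zero hε p hεL h13 X ?_
    intro ω ω' hc
    have hcl := CDNestedEdge.cluster_eq_of_conn_iff hc a₁
    rcases hX with rfl | rfl | rfl
    · simp only [Q, Set.mem_compl_iff, mem_connEvent, hc]
    · simp only [Q, U, Set.mem_inter_iff, Set.mem_compl_iff, mem_connEvent, mem_clusterInEvent, hc, hcl]
    · simp only [Q, f, Set.mem_inter_iff, Set.mem_compl_iff, mem_connEvent, hc]
  have hβ : prob p₁ (Q ∩ U) * prob p₂ Q ≤ prob p₂ (Q ∩ U) * prob p₁ Q := by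
    have h := chain_beta p hp (a₂ := a₂) h𝓔 L (insert ε (∅ : Finset E)) {a₁, a₃} hJ₀ (by simp) hends hwalk'
    rw [hchainset, hstart, hconnX Q (Or.inl rfl), hconnX (Q ∩ U) (Or.inr (Or.inl rfl))] at h
    exact h
  have hγ : prob p₂ (Q ∩ f) * prob p₁ Q ≤ prob p₁ (Q ∩ f) * prob p₂ Q := by
    have h := chain_gamma p hp (a₂ := a₂) (o := o) L (insert ε (∅ : Finset E)) {a₁, a₃} hJ₀ (by simp) hends hwalk'
    rw [hchainset, hstart, hconnX Q (Or.inl rfl), hconnX (Q ∩ f) (Or.inr (Or.inr rfl))] at h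
    exact h
  refine CDNested.cd_of_two_worlds p p₁ p₂ hp hp₁ hp₂ ends a₁ a₂ a₃ o h𝓔 (ν₁ := p ε)
    (ν₂ := (1 - p ε) * ∏ b ∈ B, p b) (hp.nonneg ε) hπ ?_ ?_ ?_ ?_ hβ hγ
  · show prob p (Q ∩ U ∩ e ∩ f) = _
    rw [eA, prob_inter_edge_or_cylinder p _ hεL]
  · show prob p (Q ∩ U ∩ e) = _
    rw [eB, prob_inter_edge_or_cylinder p _ hεL]
  · show prob p (Q ∩ e ∩ f) = _
    rw [eC, prob_inter_edge_or_cylinder p _ hεL]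
  · show prob p (Q ∩ e) = _
    rw [eD, prob_inter_edge_or_cylinder p _ hεL]

end Theorem

end CDNestedRoute

end Summit.Ventures.PercRepro2
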